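import Summits.HodgeConjecture.HodgeConjecture.Theorems.PgOneCyclotomicSquaresSpanningFamily
import Summits.HodgeConjecture.HodgeConjecture.Theorems.PgOneCyclotomicSquaresTranscendental
import Summits.HodgeConjecture.HodgeConjecture.Theorems.SeparatedCyclotomicSelfMapSquareHodgeAbstract

/-!
# Squares of surfaces (ANY `p_g`) with a self-map whose action on `T(S)` is cyclotomic with a
# SEPARATED Hodge-type table — `End_Hdg(T(S)) = ℚ[τ^*]` and the Hodge conjecture for `S × S`

Chapter «CYC-SEP» of cell hodge-nonav (planner p1 g30, memo `ROUTE-P1AC` ca0119db2de2209a, Sketch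
`ROUTE-P1AC-Sketch.lean` sha16 52b6eebf40de0c37, `namespace HodgeNonAV.P1AC` :1106–1631), landed as tree
theorems (ask A35-a) on top of the landed chapter «SQ-END» (`Theorems/PgOneCyclotomicSquaresSpanningFamily`,
`Theorems/PgOneCyclotomicSquaresTranscendental`, ask A34-a). Definition-free: the Sketch's `restrictEnd` ∕
`pullEnd` ∕ `powers` ∕ `TranscendentalEndSpannedByPullbacks` are spelled out (the restriction of `τ^*` to the
transcendental part is built inside the proof; the conclusion is the uniqueness clause of
`PgOneCyclotomicSquares.hodgeConjectureFor_square_of_endomorphisms` for the family `k ↦ τ^k`, `k < N`).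

RUNG «CYC-SEP». Let `S` be a smooth projective complex surface, `τ : S ⟶ S` an endomorphism, `ζ` a
primitive `N`-th root of unity, and `ω_u ∈ H²(S(ℂ); ℂ)` (`u ∈ (ℤ/N)ˣ`) non-zero classes with
  (E) `τ^*ω_u = ζ^u ω_u`;  (T) `ω_u` of Hodge type `(deg u, 2 - deg u)`, `deg u ∈ {0,1,2}`;
  (O) `ω_u ⊥ N¹H²(S)`;  (R) `dim N¹H²(S) + φ(N) = b₂(S)`;
  (SEP) the only unit `w` with `deg(wu) = deg u` for all `u` is `w = 1`.
Then every Hodge endomorphism of `H²(S(ℂ); ℂ)` is, on `T(S)_ℂ = (N¹H²)^⊥`, a rational combination of the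
pull-backs `(τ^k)^*`, `k < N` (`hodgeEndomorphisms_eq_sum_pullbacks_of_separated`), hence
`HodgeConjectureFor 4 (S ⊗ S)` (`hodgeConjectureFor_square_of_separatedCyclotomicSelfMap`). For `p_g = 1`
(SEP) is automatic (`separated_of_unique_deg_two`).

PROOF ARCHITECTURE. Level 1 (abstract; `Theorems/SeparatedCyclotomicSelfMapSquareHodgeAbstract`,
`coe_endAlg_mem_span_pow_of_separated`): a `ℚ`-Hodge structure `H` of rank `φ(N)` with a Hodge endomorphism
`a` whose complexification has an eigenbasis `ω_u` (eigenvalues `ζ^u`) with `ω_u ∈ F^{deg u} ∖ F^{deg u + 1}`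
and SEPARATED `deg` has `End_Hdg(H) = ℚ[a] = span{a^k : k < N}` (strong CM by `ℚ(ζ_N)` with PRIMITIVE GGK
orientation ⇒ irreducible ⇒ commutant `= η(ℚ(ζ_N))`). Level 2 (geometric, this file,
`hodgeEndomorphisms_eq_sum_pullbacks_of_separated`): apply Level 1 to the sub-Hodge structure
`T = (Hdg¹)^⊥ ⊆ H²_B(S)` (tree `exists_subHodgeStructure_orthogonal_hodgeClasses`, rank `b₂ − dim N¹ = φ(N)`
by `finrank_transcendentalLatticeBetti`), with `a = τ^*|_T` (`τ^* ∈ End_Hdg(H²_B)` is the tree's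
`BettiUniverse.pullHodgeHom`; `T` is `τ^*`-stable because `τ^*(T_ℂ) = ⊕ ℂ τ^*ω_u ⊥ N¹`, the `ω_u` spanning
`T_ℂ` by (E)+(R): distinct eigenvalues ⇒ independent) and the lifts of the `ω_u` to `T_ℂ`
(`PgOneCyclotomicSquares.exists_baseChange_eq_of_orthogonal`); a Hodge endomorphism `f` of `H²(S(ℂ); ℂ)`
descends to `g ∈ End_Hdg(H²_B)` with `g(H²) ⊆ T` (`PgOneCyclotomicSquares.exists_endAlg_of_hodgeEndomorphism`
+ Lefschetz (1,1)), and `g|_T ∈ End_Hdg(T) = span{(τ^*|_T)^k}`, the powers acting as `(τ^k)^*`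
(`PgOneCyclotomicSquares.coe_pow_apply_eq_map_pow`).

Prover seat hodge-nonav-19716-p2 g0 (`--supports stmt-HodgeConjecture-19652`, helper). No named fact, no
definition, no sorry. This is a theorem about squares of surfaces carrying such a self-map; it does NOT
prove the Hodge conjecture, nor its abelian-variety case.

References: Green–Griffiths–Kerr, *Mumford–Tate groups and domains* (2012) §V.C (i),(ii) p. 161;
Huybrechts, *Lectures on K3 surfaces* (2016) Ch. 3 Lemma 3.1, Cor. 3.6, Thm. 3.7; Zarhin, *Hodge groups of
K3 surfaces*, J. reine angew. Math. 341 (1983) Thm. 1.5.1, 1.6; Shioda, *The Hodge conjecture for Fermat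
varieties*, Math. Ann. 245 (1979) Thm. II, IV; Voisin, *Hodge Theory I* §7.3.1, §11.3.3 Thm. 11.33;
Varesco, *Hodge similarities, algebraic classes, and Kuga–Satake varieties*, Math. Z. 305 (2023) §2 p. 8.
-/

set_option linter.dupNamespace false

noncomputable section

namespace Summit.HodgeConjecture.HodgeConjecture.Theorems.SeparatedCyclotomicSelfMapSquareHodge

open scoped TensorProduct
open CategoryTheory MonoidalCategory
open Literature.AlgebraicGeometry Literature.AlgebraicGeometry.Motives Literature.AlgebraicGeometry.HodgeTheory
open Literature.AlgebraicTopology.SingularHomology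
open Literature.AlgebraicGeometry.Motives.HodgeStructure Literature.AlgebraicGeometry.Surfaces
open Summit.HodgeConjecture.HodgeConjecture.Theorems.OddPrimeSquares
open Summit.HodgeConjecture.HodgeConjecture.Theorems.PgOneCyclotomicSquares
open Polynomial



variable {S : SchemeOver ℂ}

/-- `H²_B(S)`: the weight-two `ℚ`-Hodge structure on `H²(S(ℂ); ℚ)` of the real Hodge model of `S` (tree notation). -/
local notation3 "H²[" hS "]" =>
  bettiTwoHodgeStructure hS (BettiUniverse.realHodgeModel exists_isReal_hodgeModel_holds hS)
    (BettiUniverse.realHodgeModel_isHodgeSymmetric exists_isReal_hodgeModel_holds hS)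

/-- `T(S)_ℚ = Hdg¹^⊥ ⊆ H²(S(ℂ); ℚ)` (tree notation). -/
local notation3 "T[" hS "]" =>
  transcendentalLatticeBetti hS (BettiUniverse.realHodgeModel exists_isReal_hodgeModel_holds hS)
    (BettiUniverse.realHodgeModel_isHodgeSymmetric exists_isReal_hodgeModel_holds hS)

/-- `Θ : ℂ ⊗_ℚ H²(S(ℂ); ℚ) → H²(S(ℂ); ℂ)` (tree notation). -/
local notation3 "Θ[" S "]" => ofRatClassBaseChange (Motives.ComplexPoints S) (2 * 1)

/-- `τ^[k]`: the `k`-th power of a self-map `τ : S ⟶ S`, taken in the monoid `End S`. Local notation only. -/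
local notation3 τ "^[" k "]" => ((CategoryTheory.End.of τ ^ (k : ℕ) : CategoryTheory.End _) : _ ⟶ _)

/-! ### CYC-SEP, Level 2 (geometric): squares of surfaces with a SEPARATED cyclotomic self-map -/

/-- `Θ ∘ (ι_T ⊗ ℂ)` intertwines `τ^*` on `H²(S(ℂ); ℂ)` with `a ⊗ ℂ` on `T_ℂ`, for `a ∈ End_Hdg(T)` acting on
`T ⊆ H²(S(ℂ); ℚ)` as `τ^*` (the case `k = 1` of `PgOneCyclotomicSquares.map_pow_ofRatClassBaseChange_subtype`).
[cite: VoisinHodgeI2002, §7.3.1] -/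
theorem map_ofRatClassBaseChange_subtype (hS : IsSmoothProjective 2 S) {T : SubHodgeStructure (H²[hS])}
    (τ : S ⟶ S) (a : T.toHodgeStructure.endAlg)
    (ha : ∀ w : T.toSubmodule, (((a : Module.End ℚ T.toSubmodule) w : T.toSubmodule) : bettiCohomology S (2 * 1)) =
      bettiCohomology.map τ (2 * 1) (w : bettiCohomology S (2 * 1)))
    (u : ℂ ⊗[ℚ] T.toSubmodule) :
    complexBetti.map τ (2 * 1) (Θ[S] (T.toSubmodule.subtype.baseChange ℂ u)) =
      Θ[S] (T.toSubmodule.subtype.baseChange ℂ ((a : Module.End ℚ T.toSubmodule).baseChange ℂ u)) := by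
  induction u using TensorProduct.induction_on with
  | zero => simp only [map_zero]
  | tmul c w =>
    rw [LinearMap.baseChange_tmul, ofRatClassBaseChange_tmul, map_smul, Submodule.subtype_apply, map_ofRatClass,
      LinearMap.baseChange_tmul, LinearMap.baseChange_tmul, ofRatClassBaseChange_tmul, Submodule.subtype_apply, ha]
  | add x y hx hy => rw [map_add, map_add, map_add, hx, hy, map_add, map_add, map_add]

/-- **KERNEL — rung «CYC-SEP»: `End_Hdg(T(S)) = ℚ[τ^*]` on `T` for a surface with a self-map whose action
on `T(S)_ℂ` is cyclotomic with a SEPARATED type table.** `S` any smooth projective complex surface (any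
`p_g`), `τ : S ⟶ S` any endomorphism, `ζ` a primitive `N`-th root of unity; `ω_u` (`u ∈ (ℤ/N)ˣ`) non-zero
classes with `τ^*ω_u = ζ^u ω_u`, `ω_u` of Hodge type `(deg u, 2 - deg u)` and `⊥ N¹H²(S)`, and
`dim N¹H² + φ(N) = b₂` (so `T(S)_ℂ = ⊕ ℂω_u`). If no unit `w ≠ 1` satisfies `deg(wu) = deg u` for all `u`
(SEPARATION; automatic when `p_g = 1`, `separated_of_unique_deg_two`), then every rational type-preserving
endomorphism `f` of `H²(S(ℂ); ℂ)` with image `⊥ N¹H²(S)` is, on `T(S)_ℂ = (N¹H²)^⊥`, a rational combination of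
the pull-backs `(τ^k)^*`, `k < N` (the hypothesis «`f` kills `N¹H²`» of the uniqueness clause of
`PgOneCyclotomicSquares.hodgeConjectureFor_square_of_endomorphisms` is carried but not used).
Proof: Level 1 (`coe_endAlg_mem_span_pow_of_separated`) on the sub-Hodge structure `T = (Hdg¹)^⊥`
(tree `exists_subHodgeStructure_orthogonal_hodgeClasses`), with `a = τ^*|_T` and the lifts of the `ω_u` to `T_ℂ`.
[cite: GreenGriffithsKerr2012, §V.C (i),(ii) p. 161] [cite: Huybrechts2016K3, Ch. 3 Lemma 3.1, Cor. 3.6, Thm. 3.7]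
[cite: Shioda1979, Thm. II] [cite: VoisinHodgeI2002, §7.3.1–7.3.2] -/
theorem hodgeEndomorphisms_eq_sum_pullbacks_of_separated (hS : IsSmoothProjective 2 S)
    (τ : S ⟶ S) {N : ℕ} (hN : 0 < N) {ζ : ℂ} (hζ : IsPrimitiveRoot ζ N)
    (deg : (ZMod N)ˣ → ℕ) (hdeg : ∀ u, deg u ≤ 2)
    (ω : (ZMod N)ˣ → complexBetti S (2 * 1)) (hω0 : ∀ u, ω u ≠ 0)
    (hωtype : ∀ u, IsOfHodgeType 2 S (2 * 1) (deg u) (2 - deg u) (ω u))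
    (hωorth : ∀ u, ∀ d ∈ algebraicClasses S 1, cupProduct (rfl : 2 * 1 + 2 * 1 = 2 * 2) (ω u) d = 0)
    (heig : ∀ u, complexBetti.map τ (2 * 1) (ω u) = ζ ^ (u : ZMod N).val • ω u)
    (hrk : Module.finrank ℂ (algebraicClasses S 1) + Nat.totient N =
      Module.finrank ℂ (complexBetti S (2 * 1)))
    (hsep : ∀ w : (ZMod N)ˣ, (∀ u, deg (w * u) = deg u) → w = 1)
    (f : complexBetti S (2 * 1) →ₗ[ℂ] complexBetti S (2 * 1))
    (hf₁ : ∀ y, IsRationalClass y → IsRationalClass (f y))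
    (hf₂ : ∀ (i j : ℕ) y, IsOfHodgeType 2 S (2 * 1) i j y → IsOfHodgeType 2 S (2 * 1) i j (f y))
    (_hf₃ : ∀ d ∈ algebraicClasses S 1, f d = 0)
    (hf₄ : ∀ y : complexBetti S (2 * 1), ∀ d ∈ algebraicClasses S 1,
      cupProduct (rfl : 2 * 1 + 2 * 1 = 2 * 2) (f y) d = 0) :
    ∃ (a : ℂ) (b : Fin N → ℂ), ∀ y : complexBetti S (2 * 1),
      (∀ d ∈ algebraicClasses S 1, cupProduct (rfl : 2 * 1 + 2 * 1 = 2 * 2) y d = 0) →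
      f y = a • y + ∑ k, b k • complexBetti.map (τ^[k]) (2 * 1) y := by
  haveI : Module.Finite ℚ (bettiCohomology S (2 * 1)) := BettiUniverse.finite hS (2 * 1)
  haveI : NeZero N := ⟨hN.ne'⟩
  have h4 : 2 * 1 + 2 * 1 = 2 * 2 := rfl
  set M := BettiUniverse.realHodgeModel exists_isReal_hodgeModel_holds hS with hMdef
  have hI := hodgePQ_independent_of_hodgeModel_holds
  -- (1) the transcendental sub-Hodge structure `T = (Hdg¹)^⊥`, of rank `φ(N)`
  obtain ⟨T, hT⟩ : ∃ T : SubHodgeStructure (H²[hS]), T.toSubmodule = T[hS] :=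
    exists_subHodgeStructure_orthogonal_hodgeClasses (cupPairingBetti hS) (cupPairingBetti_nondegenerate hS)
      (hodge_F_apply_eq_zero hS)
  have hrkT : Module.finrank ℚ T.toSubmodule = Nat.totient N := by
    rw [hT, finrank_transcendentalLatticeBetti hS]; omega
  -- (2) descend `f` to `g ∈ End_Hdg(H²_B(S))`, with `g(H²) ⊆ T`
  obtain ⟨g, hgofRat, hg⟩ := exists_endAlg_of_hodgeEndomorphism hS f hf₁ hf₂
  have hNcl : ∀ h ∈ (H²[hS]).hodgeClasses 1,
      ofRatClass (Motives.ComplexPoints S) (2 * 1) h ∈ algebraicClasses S 1 := fun h hh ↦ by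
    rw [← map_hodgeClasses_baseChange_eq_algebraicClasses hS]
    exact ⟨(1 : ℂ) ⊗ₜ h, Submodule.tmul_mem_baseChange_of_mem 1 hh, by rw [ofRatClassBaseChange_tmul, one_smul]⟩
  have hmemT : ∀ v : bettiCohomology S (2 * 1),
      (∀ d ∈ algebraicClasses S 1,
        cupProduct h4 (ofRatClass (Motives.ComplexPoints S) (2 * 1) v) d = 0) → v ∈ T.toSubmodule := by
    intro v hv
    rw [hT, mem_transcendentalLatticeBetti_iff]
    intro h hh
    rw [cupPairingBetti_apply]
    have hc : cupProduct (X := Motives.ComplexPoints S) (R := ℚ) h4 h v = 0 := by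
      apply ofRatClass_injective (Y := Motives.ComplexPoints S) (2 * 2)
      rw [map_zero, ofRatClass_eq_ringChange, singularCohomology.ringChange_cupProduct,
        ← ofRatClass_eq_ringChange, ← ofRatClass_eq_ringChange,
        cupProduct_gradedComm_holds ℂ (Motives.ComplexPoints S) h4 h4, hv _ (hNcl h hh), smul_zero]
    rw [hc, map_zero]
  have hgT : ∀ v, (g : Module.End ℚ (bettiCohomology S (2 * 1))) v ∈ T.toSubmodule := fun v ↦
    hmemT _ fun d hd ↦ by rw [hgofRat]; exact hf₄ _ d hd
  -- the restriction `g' = g|_T ∈ End_Hdg(T)`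
  set g' : T.toHodgeStructure.endAlg :=
    ⟨(((endAlg.toHom g).comp T.subtypeHom).codRestrict T fun w ↦ hgT (w : bettiCohomology S (2 * 1))).toLinearMap,
      Hom.toLinearMap_mem_endAlg _⟩ with hg'def
  have hg' : ∀ w : T.toSubmodule, (((g' : Module.End ℚ T.toSubmodule) w : T.toSubmodule) :
      bettiCohomology S (2 * 1)) = (g : Module.End ℚ (bettiCohomology S (2 * 1))) w := fun w ↦ rfl
  -- (3) the eigenclasses lift to `T_ℂ` and span it
  have hlift : ∀ u, ∃ x : ℂ ⊗[ℚ] T.toSubmodule, Θ[S] (T.toSubmodule.subtype.baseChange ℂ x) = ω u :=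
    fun u ↦ exists_baseChange_eq_of_orthogonal hS hT (hωorth u)
  choose ωT hωT using hlift
  have hμ : Function.Injective fun u : (ZMod N)ˣ ↦ ζ ^ (u : ZMod N).val := pow_val_injective hζ
  have hliω : LinearIndependent ℂ ω :=
    Module.End.eigenvectors_linearIndependent' (complexBetti.map τ (2 * 1)).hom _ hμ ω fun u ↦
      ⟨Module.End.mem_eigenspace_iff.2 (heig u), hω0 u⟩
  have hliT : LinearIndependent ℂ ωT := by
    refine LinearIndependent.of_comp ((Θ[S]) ∘ₗ T.toSubmodule.subtype.baseChange ℂ) ?_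
    have e : ⇑((Θ[S]) ∘ₗ T.toSubmodule.subtype.baseChange ℂ) ∘ ωT = ω := funext fun u ↦ hωT u
    rw [e]
    exact hliω
  have hcardT : Fintype.card (ZMod N)ˣ = Module.finrank ℂ (ℂ ⊗[ℚ] T.toSubmodule) := by
    rw [ZMod.card_units_eq_totient, Module.finrank_baseChange, hrkT]
  have hspanT : Submodule.span ℂ (Set.range ωT) = ⊤ := hliT.span_eq_top_of_card_eq_finrank' hcardT
  -- (4) `τ^*` preserves `T`: `τ^*(Θ T_ℂ) = τ^*(⊕ ℂω_u) ⊥ N¹`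
  have hTC : ∀ x : ℂ ⊗[ℚ] T.toSubmodule, ∀ d ∈ algebraicClasses S 1,
      cupProduct h4 (complexBetti.map τ (2 * 1) (Θ[S] (T.toSubmodule.subtype.baseChange ℂ x))) d = 0 := by
    intro x d hd
    have hx : x ∈ Submodule.span ℂ (Set.range ωT) := by rw [hspanT]; exact Submodule.mem_top
    obtain ⟨c, rfl⟩ := (Submodule.mem_span_range_iff_exists_fun ℂ).1 hx
    simp only [map_sum, map_smul, hωT, heig, LinearMap.sum_apply, LinearMap.smul_apply,
      fun u ↦ hωorth u d hd, smul_zero, Finset.sum_const_zero]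
  -- `τ^* ∈ End_Hdg(H²_B(S))` (tree `BettiUniverse.pullHodgeHom`) and its restriction `a = τ^*|_T ∈ End_Hdg(T)`
  set gτ : (H²[hS]).endAlg :=
    ⟨(BettiUniverse.pullHodgeHom exists_isReal_hodgeModel_holds hodgePQ_independent_of_hodgeModel_holds hS hS τ
        (2 * 1)).toLinearMap, Hom.toLinearMap_mem_endAlg _⟩ with hgτdef
  have hgτ : ∀ v, (gτ : Module.End ℚ (bettiCohomology S (2 * 1))) v = bettiCohomology.map τ (2 * 1) v := by
    intro v
    show (BettiUniverse.pullHodgeHom exists_isReal_hodgeModel_holds hodgePQ_independent_of_hodgeModel_holds hS hS τ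
      (2 * 1)).toLinearMap v = _
    rw [BettiUniverse.pullHodgeHom_toLinearMap]
  have hτT : ∀ w ∈ T.toSubmodule,
      (gτ : Module.End ℚ (bettiCohomology S (2 * 1))) w ∈ T.toSubmodule := by
    intro w hw
    apply hmemT
    intro d hd
    rw [hgτ, ← map_ofRatClass]
    have := hTC ((1 : ℂ) ⊗ₜ[ℚ] (⟨w, hw⟩ : T.toSubmodule)) d hd
    rwa [LinearMap.baseChange_tmul, ofRatClassBaseChange_tmul, one_smul, Submodule.subtype_apply] at this
  set a : T.toHodgeStructure.endAlg :=
    ⟨(((endAlg.toHom gτ).comp T.subtypeHom).codRestrict T fun w ↦ hτT _ w.2).toLinearMap,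
      Hom.toLinearMap_mem_endAlg _⟩ with hadef
  have ha : ∀ w : T.toSubmodule, (((a : Module.End ℚ T.toSubmodule) w : T.toSubmodule) :
      bettiCohomology S (2 * 1)) = bettiCohomology.map τ (2 * 1) (w : bettiCohomology S (2 * 1)) := fun w ↦
    hgτ w
  -- (5) the abstract theorem (Level 1) on `T`
  have hΘι_inj : Function.Injective fun x : ℂ ⊗[ℚ] T.toSubmodule ↦
      Θ[S] (T.toSubmodule.subtype.baseChange ℂ x) :=
    (ofRatClassBaseChange_injective (Motives.ComplexPoints S) (2 * 1)).comp
      (baseChange_injective_of_injective T.toSubmodule.injective_subtype)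
  have hωT0 : ∀ u, ωT u ≠ 0 := fun u h0 ↦ hω0 u (by rw [← hωT u, h0, map_zero, map_zero])
  have heigT : ∀ u, ((a : Module.End ℚ T.toSubmodule).baseChange ℂ) (ωT u) = ζ ^ (u : ZMod N).val • ωT u := by
    intro u
    apply hΘι_inj
    show Θ[S] (T.toSubmodule.subtype.baseChange ℂ _) = Θ[S] (T.toSubmodule.subtype.baseChange ℂ _)
    rw [← map_ofRatClassBaseChange_subtype hS τ a ha, hωT, heig, map_smul, map_smul, hωT]
  have hpiece : ∀ u, T.toSubmodule.subtype.baseChange ℂ (ωT u) ∈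
      (H²[hS]).piece (deg u : ℤ) ((2 - deg u : ℕ) : ℤ) := by
    intro u
    rw [cast_piece, HodgeModel.piece_eq_ratPiece _ _ _ (show deg u + (2 - deg u) = 2 * 1 by have := hdeg u; omega),
      HodgeModel.mem_ratPiece_iff, HodgeModel.complexification_apply, hωT]
    obtain ⟨B, hB⟩ := hωtype u
    exact hI 2 S hS B M (2 * 1) _ _ _ hB
  have hF : ∀ u, ωT u ∈ T.toHodgeStructure.F (deg u : ℤ) := fun u ↦
    (H²[hS]).piece_le_F _ _ (hpiece u)
  have hnF : ∀ u, ωT u ∉ T.toHodgeStructure.F ((deg u : ℤ) + 1) := by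
    intro u hu
    have ha' : T.toSubmodule.subtype.baseChange ℂ (ωT u) ∈ (H²[hS]).F ((deg u : ℤ) + 1) := hu
    have hb := (H²[hS]).piece_le_complexConj_F _ _ (hpiece u)
    have hc : T.toSubmodule.subtype.baseChange ℂ (ωT u) ∈
        (H²[hS]).F ((deg u : ℤ) + 1) ⊓ complexConj ((H²[hS]).F ((2 - deg u : ℕ) : ℤ)) := ⟨ha', hb⟩
    rw [((H²[hS]).isCompl_F_complexConj _ _ (by have := hdeg u; omega)).inf_eq_bot, Submodule.mem_bot] at hc
    exact hωT0 u (baseChange_injective_of_injective T.toSubmodule.injective_subtype (by rw [hc, map_zero]))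
  have hmem : (g' : Module.End ℚ T.toSubmodule) ∈
      Submodule.span ℚ (Set.range fun k : Fin N ↦ (a : Module.End ℚ T.toSubmodule) ^ (k : ℕ)) :=
    coe_endAlg_mem_span_pow_of_separated a hN hζ (fun u ↦ (deg u : ℤ)) ωT hωT0
      hF hnF heigT hrkT (fun w hw ↦ hsep w fun u ↦ by exact_mod_cast hw u) g'
  obtain ⟨c, hc⟩ := (Submodule.mem_span_range_iff_exists_fun ℚ).1 hmem
  have hstar : ∀ w : T.toSubmodule, (g : Module.End ℚ (bettiCohomology S (2 * 1))) w =
      ∑ k : Fin N, c k • bettiCohomology.map (τ^[k]) (2 * 1) (w : bettiCohomology S (2 * 1)) := by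
    intro w
    rw [← hg' w, ← hc]
    simp only [LinearMap.sum_apply, LinearMap.smul_apply, Submodule.coe_sum, Submodule.coe_smul]
    refine Finset.sum_congr rfl fun k _ ↦ ?_
    rw [← SubmonoidClass.coe_pow, coe_pow_apply_eq_map_pow hS τ a ha]
  -- (6) conclusion on `(N¹H²)^⊥ = Θ(T_ℂ)`
  refine ⟨0, fun k ↦ (c k : ℂ), fun y hy ↦ ?_⟩
  obtain ⟨u, rfl⟩ := exists_baseChange_eq_of_orthogonal hS hT hy
  rw [zero_smul, zero_add]
  clear hy
  induction u using TensorProduct.induction_on with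
  | zero => simp only [map_zero, smul_zero, Finset.sum_const_zero]
  | tmul c' w =>
    rw [LinearMap.baseChange_tmul, ofRatClassBaseChange_tmul, Submodule.subtype_apply, map_smul, ← hgofRat,
      hstar w, map_sum, Finset.smul_sum]
    refine Finset.sum_congr rfl fun k _ ↦ ?_
    rw [Motives.ofRatClass_smul, map_smul, map_ofRatClass, smul_comm]
  | add x y hx hy =>
    rw [map_add, map_add, map_add, hx, hy, ← Finset.sum_add_distrib]
    refine Finset.sum_congr rfl fun k _ ↦ ?_
    rw [map_add, smul_add]

/-- **KERNEL — rung «CYC-SEP» ⇒ `HC⁴(S × S)`**: under the hypotheses of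
`hodgeEndomorphisms_eq_sum_pullbacks_of_separated` (a self-map with cyclotomic, SEPARATED action on `T(S)`),
`HodgeConjectureFor 4 (S ⊗ S)` — by SQ-AUT (`PgOneCyclotomicSquares.hodgeConjectureFor_square_of_endomorphisms`:
the graphs of the `τ^k` are algebraic self-correspondences acting as `(τ^k)^*`). For `p_g = 1` surfaces this is
the rung PG1-CM-AUT up to the eigenbasis bookkeeping (`separated_of_unique_deg_two`); for `p_g ≥ 2` it is a
mechanism for `HC⁴(S × S)` off K3 type ∕ abelian type. It does not prove the Hodge conjecture.
[cite: VoisinHodgeI2002, §11.3.3, Thm. 11.33] [cite: Huybrechts2016K3, Ch. 3 Cor. 3.6, Thm. 3.7]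
[cite: GreenGriffithsKerr2012, §V.C] [cite: Varesco2023, §2 (p. 8)] -/
theorem hodgeConjectureFor_square_of_separatedCyclotomicSelfMap (hS : IsSmoothProjective 2 S)
    (τ : S ⟶ S) {N : ℕ} (hN : 0 < N) {ζ : ℂ} (hζ : IsPrimitiveRoot ζ N)
    (deg : (ZMod N)ˣ → ℕ) (hdeg : ∀ u, deg u ≤ 2)
    (ω : (ZMod N)ˣ → complexBetti S (2 * 1)) (hω0 : ∀ u, ω u ≠ 0)
    (hωtype : ∀ u, IsOfHodgeType 2 S (2 * 1) (deg u) (2 - deg u) (ω u))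
    (hωorth : ∀ u, ∀ d ∈ algebraicClasses S 1, cupProduct (rfl : 2 * 1 + 2 * 1 = 2 * 2) (ω u) d = 0)
    (heig : ∀ u, complexBetti.map τ (2 * 1) (ω u) = ζ ^ (u : ZMod N).val • ω u)
    (hrk : Module.finrank ℂ (algebraicClasses S 1) + Nat.totient N =
      Module.finrank ℂ (complexBetti S (2 * 1)))
    (hsep : ∀ w : (ZMod N)ˣ, (∀ u, deg (w * u) = deg u) → w = 1) :
    HodgeConjectureFor 4 (S ⊗ S) :=
  hodgeConjectureFor_square_of_endomorphisms hS (fun k : Fin N ↦ τ^[k])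
    (hodgeEndomorphisms_eq_sum_pullbacks_of_separated hS τ hN hζ deg hdeg ω hω0 hωtype hωorth heig hrk hsep)

/-! ### The separation condition -/

/-- **(SEP) is automatic for `p_g = 1`**: if exactly one unit has `deg = 2` (one `(2,0)`-eigenline), the type
table is separated — so CYC-SEP specialises to the PG1-CM-AUT hypotheses plus the eigenbasis bookkeeping.
[cite: Huybrechts2016K3, Ch. 3 Cor. 3.6] -/
theorem separated_of_unique_deg_two {N : ℕ} (deg : (ZMod N)ˣ → ℕ) (u₀ : (ZMod N)ˣ) (hu₀ : deg u₀ = 2)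
    (huniq : ∀ u, deg u = 2 → u = u₀) (w : (ZMod N)ˣ) (hw : ∀ u, deg (w * u) = deg u) : w = 1 := by
  have h := huniq (w * u₀) (by rw [hw, hu₀])
  exact mul_right_cancel (h.trans (one_mul u₀).symm)

/-- **(SEP) in stabiliser form**: separation says the stabiliser in `(ℤ/N)ˣ` of the type table — equivalently
of the set `P = deg⁻¹{2}` of `(2,0)`-characters when `deg` takes values in `{0,2}` off `P ∪ (−P)` — is
trivial; for a SUBGROUP-coset-free `P` this is the primitivity of the CM type `(ℚ(ζ_N), P)`.
Restated here as the contrapositive used in instance checks: a unit `w ≠ 1` stabilising `deg` violates (SEP).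
[cite: Shioda1979, Thm. II] -/
theorem not_separated_iff {N : ℕ} (deg : (ZMod N)ˣ → ℕ) :
    (¬ ∀ w : (ZMod N)ˣ, (∀ u, deg (w * u) = deg u) → w = 1) ↔
      ∃ w : (ZMod N)ˣ, w ≠ 1 ∧ ∀ u, deg (w * u) = deg u := by
  constructor
  · intro h
    by_contra hne
    exact h fun w hw ↦ by_contra fun hw1 ↦ hne ⟨w, hw1, hw⟩
  · rintro ⟨w, hw1, hw⟩ h
    exact hw1 (h w hw)

end Summit.HodgeConjecture.HodgeConjecture.Theorems.SeparatedCyclotomicSelfMapSquareHodge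

end
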